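import Literature.Combinatorics.SimpleGraph.RamseyNumbers
import Literature.Combinatorics.SimpleGraph.ArrowsCliques
import HarnessLib

/-!
# Ramsey's theorem for graphs with `r` colours (finiteness of `R_r(k)`)

The multicolour Ramsey theorem for graphs, in the elementary form used by Rödl–Ruciński (JAMS 1995,
p. 917: "`K_n → (G)_r` for `n` large") and Nenadov–Steger (CPC 2016, proof of Thm. 2, p. 2: "From
Ramsey's theorem we know that there exists `N := N(F, r)` such that every `r`-colouring of the edges
of `K_N` contains a monochromatic copy of `F`"): for all `r, k` there is `M = M(r, k)` such that every
colouring of the pairs of a set of at least `M` points with `r` colours has a `k`-subset all of whose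
pairs get the same colour.

Proof (Graham–Rothschild–Spencer, *Ramsey Theory* §1.2, the standard induction on the number of
colours): `r + 1` colours are reduced to `r` by merging — the colour-`0` graph has a `k`-clique or an
independent set of size `M(r, k)` (the two-colour theorem `R(k, l) ≤ C(k+l-2, k-1)`, here
`Literature.Combinatorics.SimpleGraph.exists_clique_or_indep_of_choose_le_card` from
`RamseyNumbers.lean`), and on such an independent set only the other `r` colours occur.

* `ramseyMulticolour_finset` — the finset form inside an arbitrary vertex type.
* `exists_arrowsCliques_top` — `∃ M, ∀ n ≥ M, K_n → (K_k)_r` (`ArrowsCliques`, `ArrowsCliques.lean`).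
* `exists_arrows_top` — `∃ M, ∀ n ≥ M, K_n → (F)_r` for every graph `F` on `Fin k` (`Arrows`).

These are theorems (no named facts). They serve the formalisation of the Rödl–Ruciński 1-statement
(`Literature.Probability.RandomGraphs.RodlRucinski1995_oneStatement`) via Ramsey supersaturation.

## References

* R. L. Graham, B. L. Rothschild, J. H. Spencer, *Ramsey Theory*, 2nd ed., Wiley 1990, §1.1–1.2
  (Ramsey's theorem for `r` colours). [GrahamRothschildSpencer1990]
* R. Nenadov, A. Steger, *A short proof of the random Ramsey theorem*, CPC 25 (2016), proof of
  Thm. 2 (p. 2). [NenadovSteger2014]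
-/

namespace Literature.Combinatorics.SimpleGraph

open Finset
open _root_.SimpleGraph

/-- **Ramsey's theorem, `r` colours, finset form.** For all `r k : ℕ` there is `M` such that for
every finset `s` with `M ≤ |s|` (in any type) and every colouring `c` of unordered pairs with `r`
colours, some `k`-subset `t ⊆ s` has all its pairs of distinct points of one colour.
(For `r = 0` the bound `M = 1` works vacuously: a point of `s` gives a pair, which has no colour.)
[cite: GrahamRothschildSpencer1990, §1.2 (Ramsey's theorem, `r` colours)] -/
theorem ramseyMulticolour_finset (r k : ℕ) : ∃ M : ℕ, ∀ {V : Type*} (s : Finset V),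
    M ≤ #s → ∀ c : Sym2 V → Fin r, ∃ t ⊆ s, #t = k ∧ ∃ i : Fin r,
      ∀ u ∈ t, ∀ v ∈ t, u ≠ v → c s(u, v) = i := by
  classical
  induction r generalizing k with
  | zero =>
    refine ⟨1, fun s hs c => ?_⟩
    obtain ⟨v, -⟩ : s.Nonempty := card_pos.mp hs
    exact (c s(v, v)).elim0
  | succ r ih =>
    rcases r with _ | r
    · -- one colour: any `k`-subset is monochromatic
      refine ⟨k, fun s hs c => ?_⟩
      obtain ⟨t, hts, htk⟩ := exists_subset_card_eq hs
      refine ⟨t, hts, htk, 0, fun u _ v _ _ => Fin.ext ?_⟩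
      have := (c s(u, v)).isLt
      simp only [Fin.val_zero]
      omega
    rcases k with _ | a
    · -- `k = 0`: the empty set
      exact ⟨0, fun s _ c => ⟨∅, empty_subset _, rfl, 0, by simp⟩⟩
    obtain ⟨M, hM⟩ := ih (a + 1)
    -- `b + 1 = max M 1` points force, in `r + 1` colours, a monochromatic `(a+1)`-set
    set b : ℕ := max M 1 - 1 with hb
    refine ⟨(a + b).choose a, fun s hs c => ?_⟩
    -- the colour-`0` graph
    set G : _root_.SimpleGraph _ := _root_.SimpleGraph.fromRel fun u v => c s(u, v) = 0 with hG
    have hGadj : ∀ u v, G.Adj u v ↔ u ≠ v ∧ c s(u, v) = 0 := by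
      intro u v
      rw [hG, fromRel_adj]
      constructor
      · rintro ⟨huv, h | h⟩
        · exact ⟨huv, h⟩
        · rw [Sym2.eq_swap]; exact ⟨huv, h⟩
      · rintro ⟨huv, h⟩
        exact ⟨huv, Or.inl h⟩
    rcases exists_clique_or_indep_of_choose_le_card G (a + b) a b rfl s hs with
      ⟨t, hts, ht⟩ | ⟨t, hts, ht⟩
    · -- an `(a+1)`-clique of colour `0`
      refine ⟨t, hts, ht.2, 0, fun u hu v hv huv => ?_⟩
      exact ((hGadj u v).1 (ht.1 hu hv huv)).2
    · -- an independent set of size `b + 1 = max M 1 ≥ M`: only colours `1, …, r + 1` inside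
      have hcard : M ≤ #t := by
        rw [ht.2, hb]
        omega
      -- shift the colours down by one
      set c' : Sym2 _ → Fin (r + 1) := fun e => ⟨(c e).val - 1, by
        have := (c e).isLt
        omega⟩ with hc'
      obtain ⟨t', ht't, ht'card, i, hi⟩ := hM t hcard c'
      refine ⟨t', ht't.trans hts, ht'card, i.succ, fun u hu v hv huv => ?_⟩
      have hne : c s(u, v) ≠ 0 := by
        intro h0
        have hadj : ¬ G.Adj u v := by
          have := ht.1 (ht't hu) (ht't hv) huv
          rw [compl_adj] at this
          exact this.2
        exact hadj ((hGadj u v).2 ⟨huv, h0⟩)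
      have h1 := hi u hu v hv huv
      rw [hc'] at h1
      simp only [Fin.ext_iff, Fin.val_succ] at h1 ⊢
      have hpos : 0 < (c s(u, v)).val := Nat.pos_of_ne_zero fun h => hne (Fin.ext h)
      omega

/-- **`K_n → (K_k)_r` for `n` large**: for all `r k` there is `M` with
`ArrowsCliques (⊤ : SimpleGraph (Fin n)) k r` for every `n ≥ M`.
[cite: GrahamRothschildSpencer1990, §1.2 (Ramsey's theorem, `r` colours)] -/
theorem exists_arrowsCliques_top (r k : ℕ) :
    ∃ M : ℕ, ∀ n : ℕ, M ≤ n → ArrowsCliques (⊤ : _root_.SimpleGraph (Fin n)) k r := by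
  obtain ⟨M, hM⟩ := ramseyMulticolour_finset r k
  refine ⟨M, fun n hn c => ?_⟩
  obtain ⟨t, -, htk, i, hi⟩ := hM (Finset.univ : Finset (Fin n)) (by simpa using hn) c
  exact ⟨t, ⟨fun u _ v _ huv => huv, htk⟩, i, hi⟩

/-- **`K_n → (F)_r` for `n` large** (Nenadov–Steger, proof of Thm. 2: "there exists `N := N(F, r)`
such that every `r`-colouring of the edges of `K_N` contains a monochromatic copy of `F`"): for
every graph `F` on `Fin k` and every `r ≥ 1` there is `M` with `Arrows ⊤ F r` on `Fin n`, `n ≥ M`.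
[cite: NenadovSteger2014, proof of Thm. 2 (p. 2)] -/
theorem exists_arrows_top {k : ℕ} (F : _root_.SimpleGraph (Fin k)) (r : ℕ) [NeZero r] :
    ∃ M : ℕ, ∀ n : ℕ, M ≤ n → Arrows (⊤ : _root_.SimpleGraph (Fin n)) F r := by
  obtain ⟨M, hM⟩ := exists_arrowsCliques_top r k
  refine ⟨M, fun n hn => ?_⟩
  have h := (arrowsCliques_iff_arrows_top (⊤ : _root_.SimpleGraph (Fin n)) k r).1 (hM n hn)
  exact h.anti_right ⟨Copy.ofLE F ⊤ le_top⟩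

end Literature.Combinatorics.SimpleGraph
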